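import Literature.NumberTheory.Automorphic.Liu2021.AppendixC.HeckePushPullPackage
import HarnessLib

/-!
# The (P3) input package of a Hecke generator with a FAITHFUL deck action, and the translate-rigidity glue
# (Liu 2021 §4.2 / App. C; Milne 2005 §5, §13; Lang VIII §6; Mumford §7)

Topic `NumberTheory/Automorphic/Liu2021/AppendixC`; namespace `Literature.NumberTheory.Automorphic.Liu2021.AppendixC`.
A PROOF FILE (theorems only: no definition ∕ structure ∕ instance ∕ named fact ∕ `sorry`), continuing ★ `HeckePushPullPackage`
(`Sec42Data.HeckeTranslates.exists_pushPull_package`).  Cell `hodgecm-mathlib` (D-0151), d6 `stub_RosH` glue, (G4Σ) weight closure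
(A-p18 (g12) 2026-08-30T06:00Z obstruction; A-plan2 (g13) 06:08Z (PT) chain, items (a)+(b)).  COUNT-NEUTRAL capital: HC_CM is proved
only modulo the 7 printed citations until rung 0 closes.

## Why
The piecewise trace word of the level cover `u : X_N → X_K` (★ `exists_fan_traceWord`) carries multiplicities
`m c′ = #ker(Stab_Δ(c′) → Aut (E_N c′))`; the (G4Σ) weight closure needs them CONSTANT, which holds as soon as (i) the deck action
`act : Δ →* Aut X_N` is injective and (ii) a translate trivial on ONE complex piece is trivial («piecewise-trivial ⇒ trivial», the
generic-stabiliser rigidity of Shimura curves, [Milne2005ShimuraVarieties] §5 p. 57 L7–12).  This file supplies (i) unconditionally —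
§0: a quotient by `act` is a quotient by the FAITHFUL action `Δ ∕ ker act` ([MumfordAV1970] §7 Remark: the universal property only sees the
set `{act δ}`); §2: the package of ★ `exists_pushPull_package` re-issued with `Function.Injective act` (the Albanese trace re-pinned on the
faithful group, [Lang1983AbelianVarieties] VIII §6 Thm. 13) — and §1 the two-line glue turning (ii), stated for ONE piece inclusion
`e : P → G X_N` and the translates `T_k (k ∈ K)`, into «`act δ` trivial along `e` ⇒ `δ = 1`» for an injective translate action.

## References
* [Liu2021] Y. Liu, *Fourier–Jacobi cycles and arithmetic relative trace formula*, Camb. J. Math. 9 (2021); §4.2 (FJcycle.tex l. 2060–2074),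
  p. 133 (before (D.3)).
* [Milne2005ShimuraVarieties] J. S. Milne, *Introduction to Shimura varieties* (2005), §5 p. 57 L7–12, p. 58 L3–11, Rem. 5.29 (c) p. 65.
* [Lang1983AbelianVarieties] S. Lang, *Abelian Varieties* (1983), Ch. VIII §6 Thm. 13 (pp. 224–227).
* [MumfordAV1970] D. Mumford, *Abelian Varieties* (1970), §7 Thm. p. 66 and Remark.
* [Bump1997] D. Bump, *Automorphic Forms and Representations* (1997), §4.2 Prop. 4.2.3.
-/

set_option autoImplicit false

noncomputable section

open CategoryTheory AlgebraicGeometry NumberField MulAction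
open Literature.AlgebraicGeometry.Motives

universe u v

namespace Literature.NumberTheory.Automorphic.Liu2021.AppendixC

/-! ## §0 Generic: a quotient by `Γ` is a quotient by the faithful group `Γ ∕ ker act` -/

/-- If `p` is a quotient by `act : Γ →* Aut Y` for separated test objects, it is a quotient by the induced FAITHFUL action of
`Γ ∕ ker act` (★ `isSepQuotient_quotientLift` at the kernel). [cite: MumfordAV1970, §7 Thm. p. 66 (Remark)] -/
theorem isSepQuotient_kerLift {k : Type u} [Field k] {Y Z : SchemeOver k} {Γ : Type v} [Group Γ]
    (act : Γ →* Aut Y) {p : Y ⟶ Z} (h : IsSepQuotient (fun g => act g) p) :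
    IsSepQuotient (fun g => QuotientGroup.kerLift act g) p :=
  isSepQuotient_quotientLift act.ker act (fun _ hn => hn) h

section Sec42

variable {F E : Type} [Field F] [NumberField F] [IsTotallyReal F] [Field E] [NumberField E] [Algebra F E]
  [IsTotallyComplex E] [Algebra.IsQuadraticExtension F E]
variable {P5 : PropC5Data F E} {isotropicAt : ℕ → Prop}

namespace Sec42Data.HeckeTranslates

variable {C : Sec42Data P5 isotropicAt} (T : C.HeckeTranslates)

/-! ## §1 The translate-rigidity glue («piecewise-trivial ⇒ trivial» ⇒ faithful stabilisers) -/

/-- **(PT) glue.**  Let `act : Δ →* Aut X_N` be an INJECTIVE action by translates `T_k`, `k ∈ K` (`hact`), `G` any functor out of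
`SchemeOver E` (the complexification) and `e : P → G X_N` a morphism (a complex piece inclusion).  If every translate `T_k` (`k ∈ K`) that
is trivial along `e` is trivial (`hPT`, the generic-stabiliser rigidity of the tower), then every `δ` with `act δ` trivial along `e` is `1` —
i.e. the stabiliser of the piece acts on it FAITHFULLY (`m c′ = 1` in ★ `exists_fan_traceWord`).
[cite: Milne2005ShimuraVarieties, §5 p. 57 L7–12 and Rem. 5.29 (c) p. 65] [cite: Liu2021, §4.2 (FJcycle.tex l. 2070–2074)] -/
theorem eq_one_of_translate_rigid {N K : C5.SmallLevel C.S.K₀} (hn : ∀ k ∈ K.1.1, C5.HeckeLE k N N)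
    {Δ : Type} [Group Δ] (act : Δ →* Aut (C.X N)) (hinj : Function.Injective act)
    (hact : ∀ δ, ∃ (k : C.G) (hk : k ∈ K.1.1), (act δ).hom = T.tr k N N (hn k hk))
    {D : Type u} [Category.{v} D] (G : SchemeOver E ⥤ D) {P : D} (e : P ⟶ G.obj (C.X N))
    (hPT : ∀ (k : C.G) (hk : k ∈ K.1.1), e ≫ G.map (T.tr k N N (hn k hk)) = e → T.tr k N N (hn k hk) = 𝟙 _)
    {δ : Δ} (hδ : e ≫ G.map (act δ).hom = e) : δ = 1 := by
  obtain ⟨k, hk, h⟩ := hact δ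
  rw [h] at hδ
  have h1 : act δ = 1 := Iso.ext (h.trans (hPT k hk hδ))
  exact hinj (h1.trans (map_one act).symm)

/-- **(PT) glue, stabiliser form**: under the same hypotheses the map `δ ↦ G.map (act δ).hom` restricted to the `δ` acting along `e`
is injective on them: two elements acting alike along `e` with `act δ₁ ≫ inv (act δ₂)` trivial along `e` coincide.  Spelled as: if
`e ≫ G.map (act (δ₁ * δ₂⁻¹)).hom = e` then `δ₁ = δ₂`. [cite: Milne2005ShimuraVarieties, §5 p. 57 L7–12] -/
theorem eq_of_translate_rigid {N K : C5.SmallLevel C.S.K₀} (hn : ∀ k ∈ K.1.1, C5.HeckeLE k N N)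
    {Δ : Type} [Group Δ] (act : Δ →* Aut (C.X N)) (hinj : Function.Injective act)
    (hact : ∀ δ, ∃ (k : C.G) (hk : k ∈ K.1.1), (act δ).hom = T.tr k N N (hn k hk))
    {D : Type u} [Category.{v} D] (G : SchemeOver E ⥤ D) {P : D} (e : P ⟶ G.obj (C.X N))
    (hPT : ∀ (k : C.G) (hk : k ∈ K.1.1), e ≫ G.map (T.tr k N N (hn k hk)) = e → T.tr k N N (hn k hk) = 𝟙 _)
    {δ₁ δ₂ : Δ} (hδ : e ≫ G.map (act (δ₁ * δ₂⁻¹)).hom = e) : δ₁ = δ₂ :=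
  mul_inv_eq_one.1 (T.eq_one_of_translate_rigid hn act hinj hact G e hPT hδ)

/-! ## §2 The (P3) input package with a faithful deck action -/

/-- **THE (P3) INPUT PACKAGE OF A HECKE GENERATOR `[Kγ₀K]` WITH AN INJECTIVE DECK ACTION.**  As ★ `exists_pushPull_package` — a level
`N ≤ K` normalised by `K`, a FINITE NON-EMPTY group `Δ` acting on `X_N` by translates (every `act δ` is some `T_k`, `k ∈ K`), an Albanese
trace `t : A_K → A_N` with `Alb_u ≫ t = Σ_δ Alb(act δ)` ([Lang1983AbelianVarieties] VIII §6 Thm. 13), a transversal `s` of `Kγ₀K ∕ K` with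
`γ⁻¹Nγ ⊆ K` on `s`, `u^N_K` a quotient of `X_N` by `act` for separated test objects — AND `act` INJECTIVE (`Δ` = the faithful quotient
`(K∕N) ∕ ker` of ★ `exists_pushPull_package`'s group, §0; the trace re-pinned on it).  With §1 this makes every piece stabiliser act
faithfully once the tower is translate-rigid. [cite: Liu2021, §4.2 (FJcycle.tex l. 2074) and p. 133 (before (D.3))]
[cite: Lang1983AbelianVarieties, Ch. VIII §6, Thm. 13 (pp. 224–227)] [cite: Milne2005ShimuraVarieties, §5 p. 58 L3–11 and Rem. 5.29 (c) p. 65]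
[cite: MumfordAV1970, §7 Thm. p. 66 (Remark)] [cite: Bump1997, §4.2 (Prop. 4.2.3)] -/
theorem exists_pushPull_package_inj (τ : E →+* ℂ)
    (hUP : ∀ ⦃N₁ K₁ : C5.SmallLevel C.S.K₀⦄ (h₁ : N₁ ≤ K₁) (hn₁ : ∀ k ∈ K₁.1.1, C5.HeckeLE k N₁ N₁)
      (W : SchemeOver E) (f : C.X N₁ ⟶ W), IsSeparated W.hom →
      (∀ (k : C.G) (hk : k ∈ K₁.1.1), T.tr k N₁ N₁ (hn₁ k hk) ≫ f = f) → ∃! fbar : C.X K₁ ⟶ W, C.cpt.X.map (homOfLE h₁) ≫ fbar = f)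
    (K : C5.SmallLevel C.S.K₀) (γ₀ : C.G) :
    ∃ (N : C5.SmallLevel C.S.K₀) (hNK : N ≤ K) (hn : ∀ k ∈ K.1.1, C5.HeckeLE k N N)
      (Δ : Type) (_ : Group Δ) (_ : Fintype Δ) (_ : Nonempty Δ) (act : Δ →* Aut (C.X N))
      (_ : Function.Injective act)
      (_ : ∀ δ, ∃ (k : C.G) (hk : k ∈ K.1.1), (act δ).hom = T.tr k N N (hn k hk))
      (t : C.A K ⟶ C.A N)
      (_ : (C.alb N).map (C.alb K) (C.cpt.X.map (homOfLE hNK)) ≫ t = ∑ δ, (C.alb N).map (C.alb N) (act δ).hom)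
      (s : Finset C.G)
      (_ : Set.BijOn (fun x : C.G => (x : C.G ⧸ (K.1.1 : Subgroup C.G))) s (orbit K.1.1 (γ₀ : C.G ⧸ (K.1.1 : Subgroup C.G))))
      (_ : ∀ γ ∈ s, C5.HeckeLE γ N K),
      IsSepQuotient (fun δ => act δ) (C.cpt.X.map (homOfLE hNK)) := by
  classical
  obtain ⟨N, hNK, hn, Δ, instG, instF, -, act, hact, -, -, s, hs, hsN, hq⟩ := T.exists_pushPull_package τ hUP K γ₀
  -- the faithful quotient `Δ ∕ ker act` and its quotient property (§0)
  have hq' : IsSepQuotient (fun g => QuotientGroup.kerLift act g) (C.cpt.X.map (homOfLE hNK)) := isSepQuotient_kerLift act hq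
  letI : Fintype (Δ ⧸ act.ker) := Fintype.ofFinite _
  -- the Albanese trace re-pinned on the faithful group (Lang VIII §6 Thm. 13)
  letI : Algebra E ℂ := τ.toAlgebra
  haveI := C.cpt.smooth_X N
  haveI := C.cpt.smooth_X K
  obtain ⟨t, ht⟩ := Albanese.exists_trace_of_isSepQuotient_complex (dX := P5.n - 1) (dY := P5.n - 1) (C.cpt.projective_X N)
    (C.cpt.projective_X K) (QuotientGroup.kerLift act) (C.cpt.X.map (homOfLE hNK)) hq' (C.alb N) (C.alb K)
  refine ⟨N, hNK, hn, Δ ⧸ act.ker, inferInstance, inferInstance, ⟨1⟩, QuotientGroup.kerLift act, QuotientGroup.kerLift_injective act,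
    fun δ => ?_, t, ht, s, hs, hsN, hq'⟩
  obtain ⟨d, rfl⟩ := QuotientGroup.mk_surjective δ
  rw [QuotientGroup.kerLift_mk]
  exact hact d

end Sec42Data.HeckeTranslates

end Sec42

end Literature.NumberTheory.Automorphic.Liu2021.AppendixC

end
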